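import Mathlib
import Summits.CriticalPhenomena.SAWScalingLimit.Theorems.SAWDefectDecoherenceObservableToSLERNestedTransferCells
import Summits.CriticalPhenomena.SAWScalingLimit.Theorems.SAWDefectDecoherenceObservableToSLERGateTransferProductCells

/-!
# Nested transfer, assembly 2: label stability and the product-cell structure from nestedness

Support file for the stub `stub_nestedTransfer` (the nested transfer
`GateDecomposition → NestedRenewal → CarvedToSLEN → HexTight → FullIdentification`) of the line
`bridge-gate-renewal` (reshape r3: nested tame gate families) for the crux
`Summit.CriticalPhenomena.SAWScalingLimit.Theses.SAWDefectDecoherence.ObservableToSLER`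
(item `stmt-CriticalPhenomena-14005`).  Replaces the crosscut topology of
`Theorems/SAWDefectDecoherenceObservableToSLERGateTransferProductCells.lean` (`eventually_productCell`)
by NESTEDNESS of the family alone:

* `isGoodGateN_of_prefix` — goodness of a level `k` with `S k ⊆ S n` is a function of the prefix
  `l₁` and the next vertex `q` among all lists `l₁ ++ rest` whose remainder starts at `q ∉ S n`
  and avoids `S n`;
* `isFirstGoodGateN_transfer` — LABEL STABILITY: the first good gate `(n; m, p, q)` of
  `l₁ ++ rest₀` (`|l₁| = m`) is the first good gate of every `l₁ ++ rest` with `rest` starting at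
  `q` and avoiding `S n` (minimality transfers through `S k ⊆ S n`, `k ≤ n`);
* `eventually_productCellN` (registered sub-goal `stub_eventuallyProductCellN`) — for a Dobrushin
  domain with an endpoint approximation, with `R₁ := dist(a, b) / 8`: for `R ≤ R₁`, all `ρ`, `N`,
  all small meshes and ALL tame nested families `S` at `a δ`, `T` at `b δ`, every critical SAW
  lies in `productCellN … (3 R)` (locality: the removed sets lie in the closed `R`-balls about
  `δ·â_δ`, `δ·b̂_δ`, which are `> 6R` apart; prefix and suffix are sub-walks inside them; the
  middle piece is nonempty; the first good gates transfer; distances by the triangle inequality).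
-/

noncomputable section

open scoped BigOperators Topology NNReal ENNReal Classical
open Filter Set MeasureTheory Metric

namespace Summit.CriticalPhenomena.SAWScalingLimit.Theorems.ObservableToSLER.NestedGate

open Literature.Probability.LatticeModels (HexVertex hexGraph hexCenter triZeta Site)
open Literature.Probability.RandomPlanarGeometry
open Literature.Probability.RandomPlanarGeometry.SAW
open Summit.CriticalPhenomena.SAWScalingLimit.Theorems.ObservableToSLER.BridgeGate

section Transfer

variable {Ω : Set ℂ} {δ ρ R : ℝ} {S : ℕ → Set HexVertex} {c : HexVertex}

/-- A tame nested family is monotone: `S k ⊆ S n` for `k ≤ n`. -/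
theorem TameNestedFamily.monotone {N : ℕ} (hS : TameNestedFamily δ R N c S) : Monotone S :=
  monotone_nat_of_le_succ hS.1

/-- **Goodness of a lower level is prefix-determined.**  Let `S k ⊆ S n` and let
`l₁ ++ rest`, `l₁ ++ rest'` be two lists with the same prefix whose remainders start at the same
vertex `q ∉ S n` and avoid `S n`.  If level `k` is good for `l₁ ++ rest` (gate `(m₂; p₂, q₂)`),
it is good for `l₁ ++ rest'` with the same gate: the first exit from `S k` happens at an index
`≤ |l₁|` and is read off `l₁` and `q`; returns to `S k` inside `l₁` are common to both lists and
impossible in the remainders (they avoid `S n ⊇ S k`); window and escape depend on `(S k, p₂, q₂)`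
only. -/
theorem isGoodGateN_of_prefix {k n : ℕ} (hkn : S k ⊆ S n) {l₁ rest rest' : List HexVertex}
    {q : HexVertex} (hq : q ∉ S n) (hh : rest.head? = some q) (hh' : rest'.head? = some q)
    (hav' : ∀ v ∈ rest', v ∉ S n) {m₂ : ℕ} {p₂ q₂ : HexVertex}
    (h : IsGoodGateN Ω δ ρ R S c (l₁ ++ rest) k m₂ p₂ q₂) :
    IsGoodGateN Ω δ ρ R S c (l₁ ++ rest') k m₂ p₂ q₂ := by
  obtain ⟨hfe, hret, hwin, hesc⟩ := h
  -- the exit index is at most `|l₁|`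
  have hm₂ : m₂ ≤ l₁.length := by
    by_contra hlt
    push Not at hlt
    have hqmem : q ∈ (l₁ ++ rest).take m₂ := List.mem_of_getElem? (i := l₁.length) (by
      rw [List.getElem?_take, if_pos hlt, List.getElem?_append_right le_rfl, Nat.sub_self,
        ← List.head?_eq_getElem?, hh])
    exact hq (hkn (hfe.2.2.1 q hqmem))
  have htake : (l₁ ++ rest').take m₂ = (l₁ ++ rest).take m₂ := by
    rw [List.take_append_of_le_length hm₂, List.take_append_of_le_length hm₂]
  have hdrop : (l₁ ++ rest).drop m₂ = l₁.drop m₂ ++ rest := List.drop_append_of_le_length hm₂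
  have hdrop' : (l₁ ++ rest').drop m₂ = l₁.drop m₂ ++ rest' := List.drop_append_of_le_length hm₂
  refine ⟨⟨?_, ?_, ?_, hfe.2.2.2⟩, ?_, hwin, hesc⟩
  · rw [htake]; exact hfe.1
  · have h2 := hfe.2.1
    rw [hdrop, List.head?_append, hh] at h2
    rw [hdrop', List.head?_append, hh']
    exact h2
  · rw [htake]; exact hfe.2.2.1
  · intro v hv
    rw [hdrop', List.mem_append] at hv
    rcases hv with hv | hv
    · exact hret v (by rw [hdrop]; exact List.mem_append_left _ hv)
    · exact fun hvk => hav' v hv (hkn hvk)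

/-- **LABEL STABILITY (one-sided transfer of the first good gate over a nested family).**  If
`L₀ = l₁ ++ rest₀` has first good gate `(n; m, p, q)` in the monotone family `S` with
`|l₁| = m`, then every list `L = l₁ ++ rest` whose remainder starts at `q` and avoids `S n` has
the same first good gate: level `n` is good for `L` by `isGoodGateN_of_prefix` (`k = n`), and a
good level `n₂ < n` for `L` would be good for `L₀` (`S n₂ ⊆ S n`), contradicting minimality. -/
theorem isFirstGoodGateN_transfer (hmono : Monotone S) {n m : ℕ} {p q : HexVertex}
    {L₀ L l₁ rest₀ rest : List HexVertex} (h₀ : IsFirstGoodGateN Ω δ ρ R S c L₀ n m p q)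
    (hL₀ : L₀ = l₁ ++ rest₀) (hL : L = l₁ ++ rest) (hl₁ : l₁.length = m)
    (hh : rest.head? = some q) (hav : ∀ v ∈ rest, v ∉ S n) :
    IsFirstGoodGateN Ω δ ρ R S c L n m p q := by
  subst hl₁ hL₀ hL
  obtain ⟨hgood₀, hmin₀⟩ := h₀
  have hq : q ∉ S n := hgood₀.1.2.2.2
  have hh₀ : rest₀.head? = some q := by
    have := hgood₀.1.2.1
    rwa [List.drop_left] at this
  have hav₀ : ∀ v ∈ rest₀, v ∉ S n := fun v hv => hgood₀.2.1 v (by rw [List.drop_left]; exact hv)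
  refine ⟨isGoodGateN_of_prefix subset_rfl hq hh₀ hh hav hgood₀, fun n₂ m₂ p₂ q₂ h₂ => ?_⟩
  by_contra hlt
  push Not at hlt
  exact absurd (hmin₀ n₂ m₂ p₂ q₂ (isGoodGateN_of_prefix (hmono hlt.le) hq hh hh₀ hav₀ h₂))
    (not_le.2 hlt)

end Transfer

section ProductCells

/-- **THE CELL STRUCTURE OVER TAME NESTED FAMILIES, EVENTUALLY** (replaces the crosscut topology
of the hexagon-level gate transfer).  For a Dobrushin domain with an endpoint approximation, with
`R₁ := dist(a, b) / 8`: for `R ≤ R₁`, every `ρ`, `N`, all small `δ` (`δ < R / 4`,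
`δ·â_δ ∈ B(a, R)`, `δ·b̂_δ ∈ B(b, R)`) and ALL tame nested families `S` at `a δ`, `T` at `b δ`,
every critical SAW lies in `productCellN … (3 R)`: the removed sets `S n`, `T n'` lie in the closed
`R`-balls about `δ·â_δ`, `δ·b̂_δ`, which are `> 6R` apart, hence are disjoint; prefix and suffix
are sub-walks inside them; `q` is within `2R` of `δ·â_δ` hence not in `T n'`, so the middle piece
is nonempty; the first good gates transfer (`isFirstGoodGateN_transfer`, twice); distances by the
triangle inequality. -/
theorem eventually_productCellN (D : DobrushinDomain) (a b : ℝ → HexVertex)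
    (hab : IsEmbEndpointApprox hexGraph hexCenter D a b) :
    ∃ R₁ > (0 : ℝ), ∀ R ∈ Set.Ioc (0 : ℝ) R₁, ∀ (ρ : ℝ) (N : ℕ), ∀ᶠ δ : ℝ in 𝓝[>] 0,
      ∀ S T : ℕ → Set HexVertex, TameNestedFamily δ R N (a δ) S → TameNestedFamily δ R N (b δ) T →
        ∀ γ₀ : HexDomainSAW D.carrier δ (a δ) (b δ),
          γ₀ ∈ productCellN D.carrier δ ρ R S T (a δ) (b δ) (3 * R) := by
  set za := D.pt 0 with hza
  set zb := D.pt 1 with hzb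
  set d := dist za zb with hd
  have hd0 : 0 < d := dist_pos.2 (DobrushinDomain_pt_ne D)
  refine ⟨d / 8, by positivity, ?_⟩
  rintro R ⟨hR0, hR1⟩ ρ N
  have hA := Metric.tendsto_nhds.1 hab.tendsto_fst R hR0
  have hB := Metric.tendsto_nhds.1 hab.tendsto_snd R hR0
  have hsmall : ∀ᶠ δ : ℝ in 𝓝[>] 0, δ < R / 4 :=
    (eventually_lt_nhds (by positivity : (0 : ℝ) < R / 4)).filter_mono nhdsWithin_le_nhds
  filter_upwards [hA, hB, hsmall, self_mem_nhdsWithin] with δ hAδ hBδ hδR hδ0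
  replace hδ0 : 0 < δ := hδ0
  have hab' : 6 * R < dist ((δ : ℂ) * hexCenter (a δ)) ((δ : ℂ) * hexCenter (b δ)) := by
    have := dist_triangle4 za ((δ : ℂ) * hexCenter (a δ)) ((δ : ℂ) * hexCenter (b δ)) zb
    linarith [dist_comm za ((δ : ℂ) * hexCenter (a δ))]
  -- adjacent vertices of `Ω_δ` have rescaled centres within `4 δ < R`
  have hdadj : ∀ {u v : HexVertex}, (hexDomainGraph D.carrier δ).Adj u v →
      dist ((δ : ℂ) * hexCenter u) ((δ : ℂ) * hexCenter v) < R := by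
    intro u v huv
    have hk := abs_rowCoord_sub_le_one_of_adj ((adj_hexDomainGraph_iff).1 huv).1.1
    have h := dist_hexCenter_le (v := u) (w := v) (k := 1) (by exact_mod_cast hk 0)
      (by exact_mod_cast hk 1)
    have h4 : ‖hexCenter u - hexCenter v‖ ≤ 4 := by rw [← dist_eq_norm]; linarith
    rw [dist_eq_norm, ← mul_sub, norm_mul, Complex.norm_real, Real.norm_eq_abs, abs_of_pos hδ0]
    calc δ * ‖hexCenter u - hexCenter v‖ ≤ δ * 4 := mul_le_mul_of_nonneg_left h4 hδ0.le
      _ < R := by linarith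
  intro S T hS hT γ₀ n m p q n' m' p' q' h₁ h₂
  set L₀ := γ₀.walk.support with hL₀
  have hrev : γ₀.walk.reverse.support = L₀.reverse := SimpleGraph.Walk.support_reverse _
  have hfe₁ : IsFirstExitFrom (S n) L₀ m p q := h₁.1.1
  have hfe₂ : IsFirstExitFrom (T n') L₀.reverse m' p' q' := h₂.1.1
  have hfe₂' : IsFirstExitFrom (T n') γ₀.walk.reverse.support m' p' q' := by rw [hrev]; exact hfe₂
  have hml := hfe₁.lt_length
  have hml' : m' < L₀.length := by have := hfe₂.lt_length; rwa [List.length_reverse] at this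
  -- the two removed sets lie in the closed balls `B(δâ, R)`, `B(δb̂, R)`, hence are disjoint
  have hSa : ∀ v ∈ S n, dist ((δ : ℂ) * hexCenter v) ((δ : ℂ) * hexCenter (a δ)) ≤ R :=
    hS.2.2.1 n
  have hTb : ∀ v ∈ T n', dist ((δ : ℂ) * hexCenter v) ((δ : ℂ) * hexCenter (b δ)) ≤ R :=
    hT.2.2.1 n'
  have hST : Disjoint (S n) (T n') := by
    refine Set.disjoint_left.2 fun v hva hvb => ?_
    have h1 := hSa v hva
    have h2 := hTb v hvb
    have := dist_triangle ((δ : ℂ) * hexCenter (a δ)) ((δ : ℂ) * hexCenter v)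
      ((δ : ℂ) * hexCenter (b δ))
    linarith [dist_comm ((δ : ℂ) * hexCenter (a δ)) ((δ : ℂ) * hexCenter v)]
  -- the prefix lies in `S n`, the suffix in `T n'`
  have hpre : ∀ v ∈ L₀.take m, v ∈ S n := hfe₁.2.2.1
  have hsuf : ∀ v ∈ L₀.drop (L₀.length - m'), v ∈ T n' := by
    intro v hv
    rw [mem_drop_length_sub_iff] at hv
    exact hfe₂.2.2.1 v hv
  -- the exit edges
  have hpq : (hexDomainGraph D.carrier δ).Adj p q := hfe₁.adj γ₀.walk
  have hp'q' : (hexDomainGraph D.carrier δ).Adj p' q' := hfe₂'.adj γ₀.walk.reverse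
  -- `q` is not in `T n'`, so the middle piece is nonempty
  have hq := hfe₁.getElem?_eq
  have hqT : q ∉ T n' := by
    intro hqT
    have h1 := hSa p hfe₁.fst_mem_set
    have h2 := hTb q hqT
    have h3 := hdadj hpq
    have := dist_triangle4 ((δ : ℂ) * hexCenter (a δ)) ((δ : ℂ) * hexCenter p)
      ((δ : ℂ) * hexCenter q) ((δ : ℂ) * hexCenter (b δ))
    linarith [dist_comm ((δ : ℂ) * hexCenter p) ((δ : ℂ) * hexCenter (a δ))]
  have hlen : m + m' < L₀.length := by
    by_contra hle
    refine hqT (hsuf q (List.mem_iff_getElem?.2 ⟨m - (L₀.length - m'), ?_⟩))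
    rw [List.getElem?_drop, show L₀.length - m' + (m - (L₀.length - m')) = m by omega]
    exact hq
  -- the walks of the prefix and of the suffix
  have hw₁ := exists_walk_take γ₀.walk γ₀.isPath hfe₁.1
  have hhead' : (L₀.drop (L₀.length - m')).head? = some p' := by
    have := hfe₂.1
    rwa [List.take_reverse, List.getLast?_reverse] at this
  have hw₂ := exists_walk_drop γ₀.walk γ₀.isPath hhead'
  refine ⟨hST, ?_, ?_, hpq, hp'q'.symm, hlen, ?_, ?_, ?_⟩
  · obtain ⟨w₁, hw₁p, hw₁s⟩ := hw₁
    exact ⟨w₁, hw₁p, hw₁s, hpre⟩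
  · obtain ⟨w₂, hw₂p, hw₂s⟩ := hw₂
    exact ⟨w₂, hw₂p, hw₂s, hsuf⟩
  · -- the transfer of the first good gates
    intro γ mid hh hl hav hsupp
    have hl₁ : (L₀.take m).length = m := by rw [List.length_take]; exact min_eq_left hml.le
    have hl₂ : (L₀.drop (L₀.length - m')).length = m' := by rw [List.length_drop]; omega
    constructor
    · refine isFirstGoodGateN_transfer hS.monotone h₁ (List.take_append_drop m L₀).symm
        (rest := mid ++ L₀.drop (L₀.length - m')) (by rw [hsupp, List.append_assoc]) hl₁
        (by rw [List.head?_append, hh]; rfl) ?_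
      intro v hv
      rw [List.mem_append] at hv
      rcases hv with hv | hv
      · exact (hav v hv).1
      · exact fun h => Set.disjoint_left.1 hST h (hsuf v hv)
    · have hsplit' : L₀.reverse = (L₀.drop (L₀.length - m')).reverse ++
          (L₀.take (L₀.length - m')).reverse := by
        rw [← List.reverse_append, List.take_append_drop]
      have hsupp' : γ.walk.support.reverse = (L₀.drop (L₀.length - m')).reverse ++
          (mid.reverse ++ (L₀.take m).reverse) := by
        rw [hsupp, List.reverse_append, List.reverse_append]
      refine isFirstGoodGateN_transfer hT.monotone h₂ hsplit' hsupp'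
        (by rw [List.length_reverse, hl₂]) (by rw [List.head?_append, List.head?_reverse, hl]; rfl) ?_
      intro v hv
      rw [List.mem_append, List.mem_reverse, List.mem_reverse] at hv
      rcases hv with hv | hv
      · exact (hav v hv).2
      · exact fun h => Set.disjoint_left.1 hST (hpre v hv) h
  · intro x hx
    have h1 := hSa x (hpre x hx)
    have h2 := hSa p hfe₁.fst_mem_set
    have h3 := hdadj hpq
    have := dist_triangle4 ((δ : ℂ) * hexCenter x) ((δ : ℂ) * hexCenter (a δ))
      ((δ : ℂ) * hexCenter p) ((δ : ℂ) * hexCenter q)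
    linarith [dist_comm ((δ : ℂ) * hexCenter p) ((δ : ℂ) * hexCenter (a δ))]
  · intro x hx
    have h1 := hTb x (hsuf x hx)
    have h2 := hTb p' hfe₂.fst_mem_set
    have h3 := hdadj hp'q'
    have := dist_triangle4 ((δ : ℂ) * hexCenter x) ((δ : ℂ) * hexCenter (b δ))
      ((δ : ℂ) * hexCenter p') ((δ : ℂ) * hexCenter q')
    linarith [dist_comm ((δ : ℂ) * hexCenter p') ((δ : ℂ) * hexCenter (b δ))]

end ProductCells

end Summit.CriticalPhenomena.SAWScalingLimit.Theorems.ObservableToSLER.NestedGate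

namespace Summit.CriticalPhenomena.SAWScalingLimit.Theorems.ObservableToSLER.NestedGate

open Literature.Probability.LatticeModels (HexVertex hexGraph hexCenter triZeta Site)
open Literature.Probability.RandomPlanarGeometry
open Literature.Probability.RandomPlanarGeometry.SAW
open Summit.CriticalPhenomena.SAWScalingLimit.Theorems.ObservableToSLER.BridgeGate

/-- **Registered sub-goal `stub_eventuallyProductCellN`** (self-contained form of `eventually_productCellN`). -/
theorem stub_eventuallyProductCellN : ∀ (D : DobrushinDomain) (a b : ℝ → HexVertex), IsEmbEndpointApprox hexGraph hexCenter D a b → ∃ R₁ > (0 : ℝ), ∀ R ∈ Set.Ioc (0 : ℝ) R₁, ∀ (ρ : ℝ) (N : ℕ), ∀ᶠ δ : ℝ in 𝓝[>] 0, ∀ S T : ℕ → Set HexVertex, TameNestedFamily δ R N (a δ) S → TameNestedFamily δ R N (b δ) T → ∀ γ₀ : HexDomainSAW D.carrier δ (a δ) (b δ), γ₀ ∈ productCellN D.carrier δ ρ R S T (a δ) (b δ) (3 * R) :=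
  fun D a b hab => eventually_productCellN D a b hab

end Summit.CriticalPhenomena.SAWScalingLimit.Theorems.ObservableToSLER.NestedGate

end
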